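import Mathlib
import Summits.NavierStokesRegularity.NavierStokesRegularity.Theorems.SymmetryModuliCountAxisymEndLiouville
import Summits.NavierStokesRegularity.NavierStokesRegularity.Theorems.TypeILiouvilleQuiescentShadow
import Summits.NavierStokesRegularity.NavierStokesRegularity.Theorems.TypeILiouvilleShadowExtraction
import Summits.NavierStokesRegularity.NavierStokesRegularity.Theorems.TypeILiouvilleTypeIliouvilleLStubOseenConstBoost
import Literature.Analysis.FluidPDE.TypeIAncientMild
import Literature.Analysis.FluidPDE.NSBoundedMildOseenClassical
import Literature.Analysis.FluidPDE.GigaMiura2011ScaledAlignmentBlowupLimitHolds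
import Summits.NavierStokesRegularity.NavierStokesRegularity.Theses.SymmetryModuliCount
import Summits.NavierStokesRegularity.NavierStokesRegularity.Theses.TypeILiouville
import Summits.NavierStokesRegularity.NavierStokesRegularity.Theses.TypeTwoEternal
import HarnessLib


/-!
# TypeILiouvilleAxisTest (part 1: the door) — decomp-ns ROOT CELL, lens 2 «structural dichotomy (special vs generic)», generation 23

(Tree part 1 of 2 — `TypeILiouvilleAxisTestDoor`: §1 symmetry lemmas, §2 the boost, §3 the CLOSED special cell of the door. Part 2 = `Theorems/TypeILiouvilleAxisTest.lean`: §4 the cuts localise, §5 AXL. The lens file's §6 «root reach» (two closure-modulo root theorems carrying the routes' other open cruxes as binders) is NOT landed — it books nothing against the root.)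

NODE «THE AXIS TEST» — the residual of the KNSS crux (L) = `Theses.TypeILiouville.TypeIliouvilleL`
(stmt-NavierStokesRegularity-10661; (L) ⟺ EL ∧ L_Q is the LANDED theorem
`Theorems.TypeILiouvilleShadowExtraction.liouvilleL_iff_eternal_and_quiescent_exact`) cut by the
STRUCTURAL dial «does the field admit an axis?»: the SPECIAL class 𝒜 consists of the print-class
fields `v` (continuous, bounded, weakly divergence-free, Oseen-mild between all pairs of negative times)
which are INFINITESIMALLY AXISYMMETRIC about some axis — there are a point `a` and a nonzero skew
`A : ℝ³ →L[ℝ] ℝ³` with `Dv(t,x)·A(x − a) − A v(t,x) = 0` for all `t < 0`, `x` (swirl allowed, any axis;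
typed VERBATIM as in the CLOSED item stmt-NavierStokesRegularity-14061
`Theses.SymmetryModuliCount.AxisymEndLiouville`) — and the GENERIC class is its complement.

KERNEL CONTENT (all unconditional, no `sorry`, no `def`, statements INLINE over tree declarations):

* §1 two elementary symmetry lemmas: ON THE AXIS THE FIELD IS AXIAL (`apply_onAxis_mem_ker`:
  `A v(t,a) = 0`), hence A STREAM APPROACHED BACKWARD IN TIME IS AXIAL (`stream_mem_ker_of_tendsto`,
  `stream_mem_ker`: `A c = 0`), and THE GALILEAN BOOST TOWARDS AN AXIAL STREAM PRESERVES THE SYMMETRY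
  (`boost_sym`);
* §2 the boost to the KNSS gauge (`isTypeIAncientMild_boost`, verbatim from the g22 lens file
  `TypeILiouvilleSelfSimilarFloor.lean` §2, whose tree landing is pending; KNSS Prop. 4.1 =
  `contDiffOn_of_bounded_oseenMild`, `stub_oseen_const_boost`);
* §3 **THE SPECIAL CELL OF THE DOOR IS CLOSED**: TFL|𝒜 «an infinitesimally axisymmetric print-class field
  fading towards a stream at the Type-I rate `√(−t)‖v(t,x) − c‖ ≤ C` IS that stream» is PROVED
  (`tfl_onAxis`) — BY NAME from the closed item stmt-14061 (`Theorems.AxisymEndLiouville_of`, θ = 0)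
  after the boost; equivalently the ledger door stmt-NavierStokesRegularity-4050
  `Theses.SymmetryModuliCount.TypeIAncientLiouville` HOLDS ON 𝒜 (`typeIAncientLiouville_onAxis`) and is
  EXACTLY its off-axis restriction (`typeIAncientLiouville_iff_offAxis`): the open core of stmt-4050 is the
  class of Type-I ancient mild fields WITHOUT an axis;
* §4 **THE CUTS LOCALISE TO 𝒜** (excluded middle on the Type-I ceiling, field by field):
  L_Q|𝒜 ⟺ SQL|𝒜 (`quiescentLiouville_onAxis_iff_slow`), BCL|𝒜 ⟺ SFL|𝒜 (`bcl_onAxis_iff_sfl`);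
  hence EXACTLY `L_Q ⟺ SQL|𝒜 ∧ L_Q|off-axis` (`quiescentLiouville_iff_axisTest`) and
  **(L) ⟺ EL ∧ SQL|𝒜 ∧ L_Q|off-axis** (`liouvilleL_iff_axisTest`, via the landed exact iff);
* §5 **THE SPECIAL CELL OF (L) IS A NAMED OPEN PROBLEM**: AXL «infinitesimally axisymmetric bounded ancient
  mild solutions are constant» = the Koch–Nadirashvili–Seregin–Šverák axisymmetric Liouville conjecture
  (KNSS 2009 p. 10: "The validity of Theorem 5.2 in the absence of the 'no swirl' assumption is still an
  open problem"; Lei–Ren–Zhang arXiv:1911.01571 p. 3: "[KNSS] conjectured that bounded mild ancient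
  solutions of axi-symmetric Navier–Stokes equations are constants"); in kernel: (L) ⟺ AXL ∧ (L)|off-axis
  (`liouvilleL_iff_axl_and_offAxis`, pointwise), AXL ⟹ SQL|𝒜 (`slowOnAxis_of_axl`) and
  EL ∧ SQL|𝒜 ⟹ AXL (`axl_of_eternal_and_slowOnAxis`, the non-quiescent axisymmetric fields being killed
  by ETERNAL LIOUVILLE through the landed shadow `shadowExtraction_holds`). Its rungs in the tree:
  KNSS Thm 5.2 (`Literature…knss_axisymmetric_no_swirl_holds`), the Type-I-in-time cell (item 14061, and
  now `tfl_onAxis`), KNSS Thm 5.3 (`knss_bound_C_over_r_*`); in print beyond the tree: Lei–Ren–Zhang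
  Thm 1 (periodic in `z`, `Γ` bounded);
* §6 root reach BY NAME through route `TypeILiouville`'s glue (`closes_root_typeI`: EL, SQL|𝒜, L_Q|off-axis;
  `closes_root_axl`: AXL, (L)|off-axis; `NoTypeII`, `KillsTypeI` carried) — closure modulo the open cells.

Helper for stmt-NavierStokesRegularity-10661 (`--supports`); closes no item. Intended tree path
`Summits/NavierStokesRegularity/NavierStokesRegularity/Theorems/TypeILiouvilleAxisTest.lean`; if the g22
file lands first, §2 is replaced by an import of `Theorems.TypeILiouvilleSelfSimilarFloorRate`.
[cite: KochNadirashviliSereginSverak2009, Thm 5.2, p. 10 open problem, Prop. 4.1 (arXiv:0709.3599)]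
[cite: LeiRenZhang2019, Thm 1 and p. 3 (arXiv:1911.01571)]
-/

noncomputable section

-- the summit and its single problem share the name `NavierStokesRegularity` (D-0017 nested layout)
set_option linter.dupNamespace false
set_option maxHeartbeats 800000

open MeasureTheory Set Function Filter
open scoped Topology
open Literature.Analysis.FluidPDE

namespace Summit.NavierStokesRegularity.NavierStokesRegularity.Theorems.TypeILiouvilleAxisTestDoor

/-! ## §1 Symmetry lemmas: the axis carries an axial field, streams are axial, boosts along the axis are symmetric -/

section Axis

variable {v : ℝ → EuclideanSpace ℝ (Fin 3) → EuclideanSpace ℝ (Fin 3)}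
  {a c : EuclideanSpace ℝ (Fin 3)} {A : EuclideanSpace ℝ (Fin 3) →L[ℝ] EuclideanSpace ℝ (Fin 3)} {C : ℝ}

/-- **On the axis the field is axial.** Evaluating the symmetry identity `Dv(t,x)·A(x − a) = A v(t,x)` at
the axis point `x = a` gives `A v(t,a) = 0`. [folklore] -/
theorem apply_onAxis_mem_ker
    (hsym : ∀ t < 0, ∀ x, fderiv ℝ (v t) x (A (x - a)) - A (v t x) = 0) {t : ℝ} (ht : t < 0) :
    A (v t a) = 0 := by
  simpa using hsym t ht a

/-- **A stream approached backward in time (at the axis point) is axial**: if `v(t,a) → c` as `t → −∞`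
then `A c = 0` (the kernel of `A` is closed). [folklore] -/
theorem stream_mem_ker_of_tendsto
    (hsym : ∀ t < 0, ∀ x, fderiv ℝ (v t) x (A (x - a)) - A (v t x) = 0)
    (hc : Tendsto (fun t => v t a) atBot (𝓝 c)) : A c = 0 := by
  have hlim : Tendsto (fun t => A (v t a)) atBot (𝓝 (A c)) := (A.continuous.tendsto c).comp hc
  have hzero : (fun t => A (v t a)) =ᶠ[atBot] fun _ => 0 :=
    (eventually_lt_atBot (0 : ℝ)).mono fun t ht => apply_onAxis_mem_ker hsym ht
  exact tendsto_nhds_unique hlim (tendsto_const_nhds.congr' hzero.symm)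

/-- **A stream approached at the Type-I rate is axial**: `√(−t)‖v(t,x) − c‖ ≤ C` for all `t < 0`, `x`
forces `A c = 0`. [folklore] -/
theorem stream_mem_ker
    (hsym : ∀ t < 0, ∀ x, fderiv ℝ (v t) x (A (x - a)) - A (v t x) = 0)
    (hC : ∀ t < 0, ∀ x, Real.sqrt (-t) * ‖v t x - c‖ ≤ C) : A c = 0 := by
  by_contra hne
  have hpos : 0 < ‖A c‖ := norm_pos_iff.2 hne
  have hC0 : 0 ≤ C := le_trans (by positivity) (hC (-1) (by norm_num) a)
  -- for every `t < 0`: `√(-t) ‖A c‖ ≤ ‖A‖ C`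
  have key : ∀ t < 0, Real.sqrt (-t) * ‖A c‖ ≤ ‖A‖ * C := by
    intro t ht
    have h1 : A c = A (c - v t a) := by rw [map_sub, apply_onAxis_mem_ker hsym ht, sub_zero]
    calc Real.sqrt (-t) * ‖A c‖ = Real.sqrt (-t) * ‖A (c - v t a)‖ := by rw [← h1]
      _ ≤ Real.sqrt (-t) * (‖A‖ * ‖c - v t a‖) :=
          mul_le_mul_of_nonneg_left (A.le_opNorm _) (Real.sqrt_nonneg _)
      _ = ‖A‖ * (Real.sqrt (-t) * ‖v t a - c‖) := by rw [norm_sub_rev]; ring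
      _ ≤ ‖A‖ * C := mul_le_mul_of_nonneg_left (hC t ht a) (norm_nonneg _)
  set R : ℝ := ‖A‖ * C / ‖A c‖ + 1 with hR
  have hR0 : 0 < R := by
    have : 0 ≤ ‖A‖ * C / ‖A c‖ := div_nonneg (mul_nonneg (norm_nonneg _) hC0) (norm_nonneg _)
    rw [hR]; linarith
  have ht : -(R ^ 2) < 0 := neg_neg_of_pos (pow_pos hR0 2)
  have h := key _ ht
  rw [neg_neg, Real.sqrt_sq hR0.le] at h
  have e : R * ‖A c‖ = ‖A‖ * C + ‖A c‖ := by
    rw [hR, add_mul, one_mul, div_mul_cancel₀ _ hpos.ne']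
  linarith

/-- **The Galilean boost towards an axial stream preserves the symmetry**: if `A c = 0` then
`w(t,y) = v(t, y + t c) − c` satisfies `Dw(t,y)·A(y − a) = A w(t,y)` (same axis point `a`:
`A(t c) = 0`). [folklore] -/
theorem boost_sym
    (hsym : ∀ t < 0, ∀ x, fderiv ℝ (v t) x (A (x - a)) - A (v t x) = 0) (hAc : A c = 0) :
    ∀ t < 0, ∀ y, fderiv ℝ ((fun t y => v t (y + t • c) - c) t) y (A (y - a)) -
      A ((fun t y => v t (y + t • c) - c) t y) = 0 := by
  intro t ht y
  have h1 : fderiv ℝ (fun y => v t (y + t • c) - c) y = fderiv ℝ (v t) (y + t • c) := by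
    rw [fderiv_sub_const, fderiv_comp_add_right]
  have h2 : A (y - a) = A (y + t • c - a) := by
    rw [add_sub_right_comm, map_add, map_smul, hAc, smul_zero, add_zero]
  have h3 : A (v t (y + t • c) - c) = A (v t (y + t • c)) := by rw [map_sub, hAc, sub_zero]
  show fderiv ℝ (fun y => v t (y + t • c) - c) y (A (y - a)) - A (v t (y + t • c) - c) = 0
  rw [h1, h2, h3]
  exact hsym t ht (y + t • c)

end Axis

/-! ## §2 The boost to the KNSS gauge (verbatim from the g22 lens file, §2; tree landing pending) -/

section Boost

/-- **Boost to the KNSS gauge.** For a P-field `v` fading towards the stream `c` at Type-I rate `C`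
(`√(−t)‖v(t,x) − c‖ ≤ C`), the Galilean-boosted field `w(t,y) = v(t, y + t c) − c` (`stub_oseen_const_boost`)
is a KNSS-gauge Type-I ancient mild field WITH THE SAME CONSTANT: jointly smooth on `t < 0` (KNSS Prop. 4.1,
`contDiffOn_of_bounded_oseenMild`, window by window), its weakly div-free smooth slices are div-free
(`IsWeaklyDivFree.isDivFree_of_contDiff`), and its mild identity is the KNSS-gauge one (`heatFlow_of_pos`).
[cite: KochNadirashviliSereginSverak2009, Prop. 4.1 and §4 (i) (arXiv:0709.3599 p. 8)] -/
theorem isTypeIAncientMild_boost {v : ℝ → EuclideanSpace ℝ (Fin 3) → EuclideanSpace ℝ (Fin 3)}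
    (hcont : ContinuousOn (uncurry v) (Iio 0 ×ˢ univ))
    (hK : ∃ K : ℝ, ∀ t < 0, ∀ x, ‖v t x‖ ≤ K)
    (hdiv : ∀ t < 0, Literature.Analysis.FluidPDE.IsWeaklyDivFree (v t))
    (hmild : ∀ s t : ℝ, s < t → t < 0 → ∀ x,
      v t x = Literature.Analysis.UnboundedOperators.heatExtension (v s) (t - s) x -
        Literature.Analysis.FluidPDE.oseenDuhamel 1 s v v t x)
    {c : EuclideanSpace ℝ (Fin 3)} {C : ℝ} (hC : ∀ t < 0, ∀ x, Real.sqrt (-t) * ‖v t x - c‖ ≤ C) :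
    IsTypeIAncientMild C (fun t y => v t (y + t • c) - c) := by
  obtain ⟨hc', ⟨K', hK'⟩, hd', hm'⟩ :=
    stub_oseen_const_boost v c hcont hK hdiv hmild
  set w : ℝ → EuclideanSpace ℝ (Fin 3) → EuclideanSpace ℝ (Fin 3) :=
    fun t y => v t (y + t • c) - c with hw_def
  -- Type-I bound of the boosted field
  have hIw : ∀ t < 0, ∀ y, Real.sqrt (-t) * ‖w t y‖ ≤ C := fun t ht y => by
    simpa [hw_def] using hC t ht (y + t • c)
  -- joint smoothness on the open slab (KNSS Prop. 4.1, window by window)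
  have hS : ContDiffOn ℝ (⊤ : ℕ∞) (uncurry w) (Iio 0 ×ˢ univ) := by
    refine contDiffOn_of_locally_contDiffOn ?_
    rintro ⟨t, x⟩ ⟨ht, -⟩
    have ht0 : t < 0 := ht
    refine ⟨Ioo (t - 1) 0 ×ˢ univ, isOpen_Ioo.prod isOpen_univ, ⟨⟨by linarith, ht0⟩, mem_univ _⟩, ?_⟩
    have h := contDiffOn_of_bounded_oseenMild (A := t - 1) (M := K') (u := w)
      (hc'.mono (prod_mono Ioo_subset_Iio_self subset_rfl)) (fun τ hτ => hd' τ hτ.2)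
      (fun s' t' _ hst ht' y => hm' s' t' hst ht' y) (fun τ hτ y => hK' τ hτ.2 y)
    exact h.mono inter_subset_right
  -- smooth weakly div-free slices are div-free
  have hslice : ∀ t < 0, ContDiff ℝ 1 (w t) := fun t ht =>
    (hS.comp_contDiff (contDiff_const.prodMk contDiff_id) fun y =>
      mk_mem_prod (mem_Iio.2 ht) (mem_univ y)).of_le (by exact_mod_cast le_top)
  have hdivc : ∀ t < 0, VectorCalculus.IsDivFree (w t) := fun t ht =>
    (hd' t ht).isDivFree_of_contDiff (hslice t ht)
  -- the KNSS-gauge mild identity and the Type-I decay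
  have hm4050 : ∀ s t : ℝ, s < t → t < 0 → ∀ x,
      w t x = heatFlow (w s) (t - s) x - oseenDuhamel 1 s w w t x := fun s t hst ht x => by
    rw [heatFlow_of_pos _ (sub_pos.2 hst)]
    exact hm' s t hst ht x
  have hdecay : HasTypeITimeDecay C w := fun t ht y => by
    rw [le_div_iff₀ (Real.sqrt_pos.2 (neg_pos.2 ht)), mul_comm]
    exact hIw t ht y
  exact ⟨hS, hdivc, hm4050, hdecay⟩

end Boost

/-! ## §3 The special cell of the door is CLOSED: Type-I-rate fading Liouville holds on 𝒜 (item 14061 BY NAME) -/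

section Door

/-- **TFL|𝒜 — PROVED.** An infinitesimally axisymmetric (about any axis, swirl allowed) print-class field
fading towards a stream `c` at the Type-I rate `√(−t)‖v(t,x) − c‖ ≤ C` IS that stream: the stream is axial
(`stream_mem_ker`), the boost towards it stays symmetric (`boost_sym`) and is a KNSS-gauge Type-I ancient
mild field (`isTypeIAncientMild_boost`), which the CLOSED item stmt-NavierStokesRegularity-14061
`Theses.SymmetryModuliCount.AxisymEndLiouville` (`Theorems.AxisymEndLiouville_of`, θ = 0) annihilates.
[cite: KochNadirashviliSereginSverak2009, Thm 5.2 and §5 (arXiv:0709.3599 p. 10)] -/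
theorem tfl_onAxis :
    ∀ v : ℝ → EuclideanSpace ℝ (Fin 3) → EuclideanSpace ℝ (Fin 3),
      ContinuousOn (uncurry v) (Iio 0 ×ˢ univ) →
      (∃ K : ℝ, ∀ t < 0, ∀ x, ‖v t x‖ ≤ K) →
      (∀ t < 0, Literature.Analysis.FluidPDE.IsWeaklyDivFree (v t)) →
      (∀ s t : ℝ, s < t → t < 0 → ∀ x,
        v t x = Literature.Analysis.UnboundedOperators.heatExtension (v s) (t - s) x -
          Literature.Analysis.FluidPDE.oseenDuhamel 1 s v v t x) →
      (∃ (a : EuclideanSpace ℝ (Fin 3)) (A : EuclideanSpace ℝ (Fin 3) →L[ℝ] EuclideanSpace ℝ (Fin 3)),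
        (∀ x, inner ℝ (A x) x = 0) ∧ A ≠ 0 ∧
          ∀ t < 0, ∀ x, fderiv ℝ (v t) x (A (x - a)) - A (v t x) = 0) →
      (∃ (c : EuclideanSpace ℝ (Fin 3)) (C : ℝ), ∀ t < 0, ∀ x, Real.sqrt (-t) * ‖v t x - c‖ ≤ C) →
      ∃ b : EuclideanSpace ℝ (Fin 3), ∀ t < 0, ∀ x, v t x = b := by
  intro v hcont hK hdiv hmild hax hI
  obtain ⟨a, A, hskew, hA, hsym⟩ := hax
  obtain ⟨c, C, hC⟩ := hI
  have hw : IsTypeIAncientMild C (fun t y => v t (y + t • c) - c) :=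
    isTypeIAncientMild_boost hcont hK hdiv hmild hC
  have hz : ∀ t < (0 : ℝ), ∀ y, (fun t y => v t (y + t • c) - c) t y = 0 :=
    AxisymEndLiouville_of C _ hw a A 0 hskew hA le_rfl (boost_sym hsym (stream_mem_ker hsym hC))
  refine ⟨c, fun t ht x => ?_⟩
  have h := hz t ht (x - t • c)
  simp only [sub_add_cancel] at h
  exact sub_eq_zero.1 h

/-- **stmt-4050 HOLDS ON 𝒜** (the closed item stmt-14061 at θ = 0, hypotheses in the literal form of
`Theses.SymmetryModuliCount.TypeIAncientLiouville`). [cite: KochNadirashviliSereginSverak2009, Thm 5.2 (arXiv:0709.3599 p. 10)] -/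
theorem typeIAncientLiouville_onAxis :
    ∀ (C : ℝ) (u : ℝ → EuclideanSpace ℝ (Fin 3) → EuclideanSpace ℝ (Fin 3)),
      ContDiffOn ℝ (⊤ : ℕ∞) (uncurry u) (Iio 0 ×ˢ univ) ∧
        (∀ t < 0, VectorCalculus.IsDivFree (u t)) ∧
        (∀ s t : ℝ, s < t → t < 0 → ∀ x, u t x = heatFlow (u s) (t - s) x -
          ∫ τ in Ioo s t, ∫ y, oseenKernel (t - τ) (x - y) (u τ y) (u τ y)) ∧
        HasTypeITimeDecay C u →
      (∃ (a : EuclideanSpace ℝ (Fin 3)) (A : EuclideanSpace ℝ (Fin 3) →L[ℝ] EuclideanSpace ℝ (Fin 3)),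
        (∀ x, inner ℝ (A x) x = 0) ∧ A ≠ 0 ∧
          ∀ t < 0, ∀ x, fderiv ℝ (u t) x (A (x - a)) - A (u t x) = 0) →
      ∀ t < 0, ∀ x, u t x = 0 := by
  intro C u hu hax
  obtain ⟨a, A, hskew, hA, hsym⟩ := hax
  exact AxisymEndLiouville_of C u (isTypeIAncientMild_iff.2 hu) a A 0 hskew hA le_rfl hsym

/-- **THE DOOR LOCALISES OFF THE AXIS: stmt-4050 ⟺ stmt-4050|off-axis.** The open core of
`TypeIAncientLiouville` (stmt-NavierStokesRegularity-4050) is the class of KNSS-gauge Type-I ancient mild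
fields admitting NO axis. [cite: KochNadirashviliSereginSverak2009, Thm 5.2 and p. 10 (arXiv:0709.3599)] -/
theorem typeIAncientLiouville_iff_offAxis :
    Theses.SymmetryModuliCount.TypeIAncientLiouville ↔
      ∀ (C : ℝ) (u : ℝ → EuclideanSpace ℝ (Fin 3) → EuclideanSpace ℝ (Fin 3)),
        ContDiffOn ℝ (⊤ : ℕ∞) (uncurry u) (Iio 0 ×ˢ univ) ∧
          (∀ t < 0, VectorCalculus.IsDivFree (u t)) ∧
          (∀ s t : ℝ, s < t → t < 0 → ∀ x, u t x = heatFlow (u s) (t - s) x -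
            ∫ τ in Ioo s t, ∫ y, oseenKernel (t - τ) (x - y) (u τ y) (u τ y)) ∧
          HasTypeITimeDecay C u →
        (¬ ∃ (a : EuclideanSpace ℝ (Fin 3)) (A : EuclideanSpace ℝ (Fin 3) →L[ℝ] EuclideanSpace ℝ (Fin 3)),
          (∀ x, inner ℝ (A x) x = 0) ∧ A ≠ 0 ∧
            ∀ t < 0, ∀ x, fderiv ℝ (u t) x (A (x - a)) - A (u t x) = 0) →
        ∀ t < 0, ∀ x, u t x = 0 := by
  refine ⟨fun h C u hu _ => h C u hu, fun h C u hu => ?_⟩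
  by_cases hax : ∃ (a : EuclideanSpace ℝ (Fin 3)) (A : EuclideanSpace ℝ (Fin 3) →L[ℝ] EuclideanSpace ℝ (Fin 3)),
      (∀ x, inner ℝ (A x) x = 0) ∧ A ≠ 0 ∧
        ∀ t < 0, ∀ x, fderiv ℝ (u t) x (A (x - a)) - A (u t x) = 0
  · exact typeIAncientLiouville_onAxis C u hu hax
  · exact h C u hu hax

end Door

end Summit.NavierStokesRegularity.NavierStokesRegularity.Theorems.TypeILiouvilleAxisTestDoor



end
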